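import Summits.AtomisticToContinuum.BoseEinsteinCondensation.Theorems.BECConjugateDominationPuffFloorInnerPairCountKernel
import Literature.MathematicalPhysics.QuantumManyBody.PeriodicEnergyFirstVariation
import Literature.MathematicalPhysics.QuantumManyBody.DiluteBoseGasUpperBoundLocalization

/-!
# Route `BECConjugateDomination`, crux `PuffFloor` (stmt-AtomisticToContinuum-11785),
# line `coupling-slope-pocket`, stub S7in `stub_innerPairCount` — counting and the barrier

Supports (does not close) stmt-AtomisticToContinuum-11785. Second tools file for the lead's glue stub S7in of
skeleton v6 (`Cruxes/PuffFloor/Lines/coupling_slope_pocket.lean`):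

* `lintegral_pairIndicator_le` — the **abstract counting step**: if the periodised pair indicator is dominated
  pointwise by finitely many shifted periodised kernels and each smeared `(0,1)`-pair density is at most `C` times
  the `(0,1)`-pair potential energy density, then the expected indicator count over all pairs is at most
  `#T · C · ⟨Ψ, H(v)Ψ⟩` (Bose symmetry, `lintegral_pair_eq_pair01`);
* `periodizedProfile_flatTop`, `lintegral_weight_eq_ofReal` — bookkeeping;
* `exists_barrier` — a coreless (`v 0 = 0`), not identically vanishing, continuous finite-range profile has an
  interior barrier: `r_* > 0`, `v_max > 0`, `δ₀ ≤ r_*/2` with `v ≤ v_max` on `[0,∞)` and `v ≥ v_max/2` on the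
  band `||u| − r_*| < δ₀` (maximum on the compact `[0,R₀]`, continuity).

References: LSSY2005 Ch. 2; folklore.
-/

noncomputable section

namespace Summit.AtomisticToContinuum.BoseEinsteinCondensation.Theorems

open MeasureTheory Filter Metric
open scoped ENNReal NNReal BigOperators Laplacian Topology
open Literature.MathematicalPhysics.QuantumManyBody.BoseGas

namespace PuffFloorInnerPairCount

/-! ## Counting through a finite family of smeared densities -/

section Counting

variable {n : ℕ} {L : ℝ}

/-- Measurability of a shifted periodised profile of the pair difference. [folklore] -/
theorem measurable_periodizedPotential_pair {m : ℕ} {w : ℝ → ℝ≥0∞} {L : ℝ}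
    (hp : Measurable (periodizedPotential w L)) (i j : Fin m) (t : Space) :
    Measurable fun X : Config m => periodizedPotential w L (X i - X j - t) :=
  hp.comp (((measurable_pi_apply i).sub (measurable_pi_apply j)).sub measurable_const)

/-- **Abstract counting step.** If the periodised pair indicator is dominated pointwise by a finite family of
shifted periodised kernels `w^per(· − t)`, `t ∈ T`, and each smeared `(0,1)`-pair density is at most `C` times
the `(0,1)`-pair potential energy density, then the expected indicator count over ALL pairs is at most
`#T · C · ⟨Ψ, H(v)Ψ⟩` (Bose symmetry moves every pair to the pair `(0,1)` and back,
`lintegral_pair_eq_pair01`). [folklore] -/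
theorem lintegral_pairIndicator_le (Ψ : PeriodicTrialState (n + 2) L) {v w ind : ℝ → ℝ≥0∞}
    (hv : Measurable (periodizedPotential v L)) (hw : Measurable (periodizedPotential w L)) (T : Finset Space)
    (C : ℝ≥0∞)
    (hcover : ∀ z : Space, periodizedPotential ind L z ≤ ∑ t ∈ T, periodizedPotential w L (z - t))
    (hpair : ∀ t ∈ T, ∫⁻ X in cellN (n + 2) L, periodizedPotential w L (X 0 - X 1 - t) * (‖Ψ.ψ X‖₊ : ℝ≥0∞) ^ 2 ≤
      C * ∫⁻ X in cellN (n + 2) L, periodizedPotential v L (X 0 - X 1) * (‖Ψ.ψ X‖₊ : ℝ≥0∞) ^ 2) :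
    ∫⁻ X in cellN (n + 2) L, periodicInteraction ind L X * (‖Ψ.ψ X‖₊ : ℝ≥0∞) ^ 2 ≤
      (T.card : ℝ≥0∞) * C * periodicEnergy v Ψ := by
  set ψ := Ψ.ψ with hψdef
  have hn2 : Measurable fun X : Config (n + 2) => (‖ψ X‖₊ : ℝ≥0∞) ^ 2 :=
    (Ψ.contDiff.continuous.measurable.nnnorm.coe_nnreal_ennreal).pow_const _
  have hmw : ∀ (i j : Fin (n + 2)) (t : Space), Measurable fun X : Config (n + 2) =>
      periodizedPotential w L (X i - X j - t) * (‖ψ X‖₊ : ℝ≥0∞) ^ 2 := fun i j t =>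
    (measurable_periodizedPotential_pair hw i j t).mul hn2
  have hmv : ∀ (i j : Fin (n + 2)), Measurable fun X : Config (n + 2) =>
      periodizedPotential v L (X i - X j) * (‖ψ X‖₊ : ℝ≥0∞) ^ 2 := fun i j => by
    have h : Measurable fun X : Config (n + 2) =>
        periodizedPotential v L (X i - X j - 0) * (‖ψ X‖₊ : ℝ≥0∞) ^ 2 :=
      (measurable_periodizedPotential_pair hv i j 0).mul hn2
    simpa only [sub_zero] using h
  -- Step 1: pointwise domination and expansion into a triple sum of pair integrals
  have h1 : ∫⁻ X in cellN (n + 2) L, periodicInteraction ind L X * (‖ψ X‖₊ : ℝ≥0∞) ^ 2 ≤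
      ∑ i : Fin (n + 2), ∑ j : Fin (n + 2) with i < j, ∑ t ∈ T,
        ∫⁻ X in cellN (n + 2) L, periodizedPotential w L (X i - X j - t) * (‖ψ X‖₊ : ℝ≥0∞) ^ 2 := by
    calc ∫⁻ X in cellN (n + 2) L, periodicInteraction ind L X * (‖ψ X‖₊ : ℝ≥0∞) ^ 2
        ≤ ∫⁻ X in cellN (n + 2) L, ∑ i : Fin (n + 2), ∑ j : Fin (n + 2) with i < j, ∑ t ∈ T,
            periodizedPotential w L (X i - X j - t) * (‖ψ X‖₊ : ℝ≥0∞) ^ 2 := by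
          refine lintegral_mono fun X => ?_
          calc periodicInteraction ind L X * (‖ψ X‖₊ : ℝ≥0∞) ^ 2
              ≤ (∑ i : Fin (n + 2), ∑ j : Fin (n + 2) with i < j, ∑ t ∈ T,
                  periodizedPotential w L (X i - X j - t)) * (‖ψ X‖₊ : ℝ≥0∞) ^ 2 :=
                mul_le_mul_left (Finset.sum_le_sum fun i _ => Finset.sum_le_sum fun j _ => hcover _) _
            _ = _ := by simp_rw [Finset.sum_mul]
      _ = _ := by
          rw [lintegral_finsetSum _ fun i _ => Finset.measurable_sum _ fun j _ =>
            Finset.measurable_sum _ fun t _ => hmw i j t]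
          refine Finset.sum_congr rfl fun i _ => ?_
          rw [lintegral_finsetSum _ fun j _ => Finset.measurable_sum _ fun t _ => hmw i j t]
          refine Finset.sum_congr rfl fun j _ => ?_
          exact lintegral_finsetSum _ fun t _ => hmw i j t
  -- Step 2: every pair integral is a `(0,1)`-pair integral, bounded by `C` times the pair energy density
  have h2 : ∀ (i j : Fin (n + 2)), i < j → ∀ t ∈ T,
      ∫⁻ X in cellN (n + 2) L, periodizedPotential w L (X i - X j - t) * (‖ψ X‖₊ : ℝ≥0∞) ^ 2 ≤
        C * ∫⁻ X in cellN (n + 2) L, periodizedPotential v L (X i - X j) * (‖ψ X‖₊ : ℝ≥0∞) ^ 2 := by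
    intro i j hij t ht
    rw [lintegral_pair_eq_pair01 Ψ (fun d => periodizedPotential w L (d - t)) hij,
      lintegral_pair_eq_pair01 Ψ (fun d => periodizedPotential v L d) hij]
    exact hpair t ht
  -- Step 3: resum
  have h3 : ∑ i : Fin (n + 2), ∑ j : Fin (n + 2) with i < j, ∑ t ∈ T,
      ∫⁻ X in cellN (n + 2) L, periodizedPotential w L (X i - X j - t) * (‖ψ X‖₊ : ℝ≥0∞) ^ 2 ≤
      ∑ i : Fin (n + 2), ∑ j : Fin (n + 2) with i < j,
        ((T.card : ℝ≥0∞) * C) * ∫⁻ X in cellN (n + 2) L, periodizedPotential v L (X i - X j) * (‖ψ X‖₊ : ℝ≥0∞) ^ 2 := by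
    refine Finset.sum_le_sum fun i _ => Finset.sum_le_sum fun j hj => ?_
    have hij : i < j := (Finset.mem_filter.1 hj).2
    calc ∑ t ∈ T, ∫⁻ X in cellN (n + 2) L, periodizedPotential w L (X i - X j - t) * (‖ψ X‖₊ : ℝ≥0∞) ^ 2
        ≤ ∑ _t ∈ T, C * ∫⁻ X in cellN (n + 2) L, periodizedPotential v L (X i - X j) * (‖ψ X‖₊ : ℝ≥0∞) ^ 2 :=
          Finset.sum_le_sum fun t ht => h2 i j hij t ht
      _ = _ := by rw [Finset.sum_const, nsmul_eq_mul, mul_assoc]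
  have h4 : ∑ i : Fin (n + 2), ∑ j : Fin (n + 2) with i < j,
      ((T.card : ℝ≥0∞) * C) * ∫⁻ X in cellN (n + 2) L, periodizedPotential v L (X i - X j) * (‖ψ X‖₊ : ℝ≥0∞) ^ 2 =
      ((T.card : ℝ≥0∞) * C) * ∫⁻ X in cellN (n + 2) L, periodicInteraction v L X * (‖ψ X‖₊ : ℝ≥0∞) ^ 2 := by
    simp_rw [← Finset.mul_sum]
    congr 1
    have hexp : ∀ X : Config (n + 2), periodicInteraction v L X * (‖ψ X‖₊ : ℝ≥0∞) ^ 2 =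
        ∑ i : Fin (n + 2), ∑ j : Fin (n + 2) with i < j,
          periodizedPotential v L (X i - X j) * (‖ψ X‖₊ : ℝ≥0∞) ^ 2 := fun X => by
      simp only [periodicInteraction, Finset.sum_mul]
    simp_rw [hexp]
    rw [lintegral_finsetSum _ fun i _ => Finset.measurable_sum _ fun j _ => hmv i j]
    exact Finset.sum_congr rfl fun i _ => (lintegral_finsetSum _ fun j _ => hmv i j).symm
  calc _ ≤ _ := h1
    _ ≤ _ := h3
    _ = _ := h4
    _ ≤ (T.card : ℝ≥0∞) * C * periodicEnergy v Ψ := by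
        gcongr
        exact lintegral_mono fun X => le_add_self

end Counting

/-! ## Bookkeeping and the barrier -/

/-- **Flat top, `ℝ≥0∞` form**: if a lattice image of `z` is within `δ/2` of `t` then `w^per(z − t) ≥ 1`.
[folklore] -/
theorem periodizedProfile_flatTop {L δ : ℝ} {h : ℝ → ℝ} (hflat : ∀ r, |r| ≤ δ / 2 → h r = 1)
    {z t : Space} {q : Fin 3 → ℤ} (hq : ‖z - latticeVec L q - t‖ ≤ δ / 2) :
    1 ≤ periodizedPotential (fun r => ENNReal.ofReal (h r)) L (z - t) := by
  have hterm : ENNReal.ofReal (h ‖z - t - latticeVec L q‖) = 1 := by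
    rw [show z - t - latticeVec L q = z - latticeVec L q - t by abel,
      hflat _ (by rwa [abs_of_nonneg (norm_nonneg _)]), ENNReal.ofReal_one]
  rw [← hterm]
  exact ENNReal.le_tsum q

/-- `∫⁻ F |ψ|₊² = ofReal (∫ F.toReal |ψ|²)` on the cell for a finite measurable `ℝ≥0∞` weight `F` with continuous
`toReal` and a continuous `ψ`. [folklore] -/
theorem lintegral_weight_eq_ofReal {m : ℕ} {L : ℝ} {ψ : Config m → ℂ} (hψ : Continuous ψ)
    {F : Config m → ℝ≥0∞} (hFtop : ∀ X, F X ≠ ⊤) (hFc : Continuous fun X => (F X).toReal) :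
    ∫⁻ X in cellN m L, F X * (‖ψ X‖₊ : ℝ≥0∞) ^ 2 =
      ENNReal.ofReal (∫ X in cellN m L, (F X).toReal * ‖ψ X‖ ^ 2) := by
  have hint : IntegrableOn (fun X => (F X).toReal * ‖ψ X‖ ^ 2) (cellN m L) volume :=
    integrableOn_cellN (hFc.mul (hψ.norm.pow 2)) L
  rw [ofReal_integral_eq_lintegral_ofReal hint
    (Eventually.of_forall fun X => mul_nonneg ENNReal.toReal_nonneg (sq_nonneg _))]
  refine lintegral_congr fun X => ?_
  rw [coe_nnnorm_sq_eq_ofReal, ENNReal.ofReal_mul ENNReal.toReal_nonneg, ENNReal.ofReal_toReal (hFtop X)]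

/-- **The profile of a coreless, not identically vanishing, continuous finite-range potential has an interior
barrier**: there are `0 < r_*`, `v_max > 0` and `0 < δ₀ ≤ r_*/2` with `v ≤ v_max` on `[0,∞)` (as reals) and
`v ≥ v_max/2` on the band `||u| − r_*| < δ₀`. [folklore] -/
theorem exists_barrier (v : ℝ → ℝ≥0∞) (hfin : ∀ r, v r ≠ ⊤)
    (hC2 : ContDiff ℝ 2 (fun x : Space => (v ‖x‖).toReal)) (h0 : v 0 = 0)
    (hpos : ∃ r, 0 < r ∧ 0 < v r) {R₀ : ℝ} (hR₀ : 0 < R₀) (hrange : ∀ r, R₀ < r → v r = 0) :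
    ∃ rs vmax δ₀ : ℝ, 0 < rs ∧ 0 < vmax ∧ 0 < δ₀ ∧ δ₀ ≤ rs / 2 ∧ rs ≤ R₀ ∧
      (∀ u : Space, (v ‖u‖).toReal ≤ vmax) ∧
      (∀ u : Space, |‖u‖ - rs| < δ₀ → vmax / 2 ≤ (v ‖u‖).toReal) := by
  set e₀ : Space := EuclideanSpace.single (0 : Fin 3) (1 : ℝ) with he₀
  set g : ℝ → ℝ := fun r => (v ‖(r • e₀ : Space)‖).toReal with hg
  have hnorm : ∀ r : ℝ, ‖(r • e₀ : Space)‖ = |r| := fun r => by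
    rw [norm_smul, he₀, PiLp.norm_single, norm_one, mul_one, Real.norm_eq_abs]
  have hgc : Continuous g := hC2.continuous.comp (continuous_id.smul continuous_const)
  have hg_eq : ∀ r, 0 ≤ r → g r = (v r).toReal := fun r hr => by
    simp only [hg]
    rw [hnorm, abs_of_nonneg hr]
  obtain ⟨r₀, hr₀, hvr₀⟩ := hpos
  have hr₀R : r₀ ≤ R₀ := le_of_not_gt fun h => hvr₀.ne' (hrange r₀ h)
  obtain ⟨rs, hrs_mem, hrs_max⟩ := (isCompact_Icc : IsCompact (Set.Icc (0 : ℝ) R₀)).exists_isMaxOn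
    (Set.nonempty_Icc.2 hR₀.le) hgc.continuousOn
  have hrs0 : 0 ≤ rs := hrs_mem.1
  set vmax := g rs with hvmax
  have hvr₀' : 0 < (v r₀).toReal := ENNReal.toReal_pos hvr₀.ne' (hfin r₀)
  have hmax : ∀ r ∈ Set.Icc (0 : ℝ) R₀, g r ≤ g rs := isMaxOn_iff.1 hrs_max
  have hvmax_pos : 0 < vmax := by
    have h := hmax r₀ ⟨hr₀.le, hr₀R⟩
    rw [hg_eq r₀ hr₀.le] at h
    exact hvr₀'.trans_le h
  have hrs_pos : 0 < rs := by
    rcases hrs0.eq_or_lt with h | h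
    · exfalso
      have : vmax = 0 := by rw [hvmax, ← h, hg_eq 0 le_rfl, h0, ENNReal.toReal_zero]
      exact hvmax_pos.ne' this
    · exact h
  -- `v ≤ vmax` everywhere on `[0, ∞)`
  have hle : ∀ u : Space, (v ‖u‖).toReal ≤ vmax := by
    intro u
    by_cases hu : ‖u‖ ≤ R₀
    · have h := hmax ‖u‖ ⟨norm_nonneg u, hu⟩
      rwa [hg_eq _ (norm_nonneg u)] at h
    · rw [hrange _ (not_le.1 hu), ENNReal.toReal_zero]
      exact hvmax_pos.le
  -- the band
  obtain ⟨δ₁, hδ₁, hδ₁'⟩ := Metric.continuous_iff.1 hgc rs (vmax / 2) (by positivity)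
  refine ⟨rs, vmax, min (δ₁ / 2) (rs / 2), hrs_pos, hvmax_pos, lt_min (by positivity) (by positivity),
    min_le_right _ _, hrs_mem.2, hle, fun u hu => ?_⟩
  have hu1 : |‖u‖ - rs| < δ₁ := hu.trans_le ((min_le_left _ _).trans (by linarith))
  have hupos : 0 ≤ ‖u‖ := norm_nonneg u
  have h := hδ₁' ‖u‖ (by rwa [Real.dist_eq])
  rw [hg_eq _ hupos, Real.dist_eq] at h
  have h' := (abs_lt.1 h).1
  linarith

end PuffFloorInnerPairCount

open PuffFloorInnerPairCount in
/-- **Registered helper `puffFloor_pairIndicatorCount`** (sub-goal of stmt-AtomisticToContinuum-11785 for the counting tools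
of stub S7in): the abstract counting step — `PuffFloorInnerPairCount.lintegral_pairIndicator_le`. Folklore. -/
theorem puffFloor_pairIndicatorCount :
    ∀ (n : ℕ) (L : ℝ) (Ψ : PeriodicTrialState (n + 2) L) (v w ind : ℝ → ℝ≥0∞),
      Measurable (periodizedPotential v L) → Measurable (periodizedPotential w L) →
      ∀ (T : Finset Space) (C : ℝ≥0∞),
      (∀ z : Space, periodizedPotential ind L z ≤ ∑ t ∈ T, periodizedPotential w L (z - t)) →
      (∀ t ∈ T, ∫⁻ X in cellN (n + 2) L, periodizedPotential w L (X 0 - X 1 - t) * (‖Ψ.ψ X‖₊ : ℝ≥0∞) ^ 2 ≤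
        C * ∫⁻ X in cellN (n + 2) L, periodizedPotential v L (X 0 - X 1) * (‖Ψ.ψ X‖₊ : ℝ≥0∞) ^ 2) →
      ∫⁻ X in cellN (n + 2) L, periodicInteraction ind L X * (‖Ψ.ψ X‖₊ : ℝ≥0∞) ^ 2 ≤
        (T.card : ℝ≥0∞) * C * periodicEnergy v Ψ :=
  fun _n _L Ψ _v _w _ind hv hw T C hcover hpair => lintegral_pairIndicator_le Ψ hv hw T C hcover hpair

end Summit.AtomisticToContinuum.BoseEinsteinCondensation.Theorems

end
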